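import Mathlib
import Summits.Ventures.PercRepro2.HCov
import Summits.Ventures.PercRepro2.RootLeafUSigns
import Summits.Ventures.PercRepro2.RootLeafUSecond
import Summits.Ventures.PercRepro2.RootLeafUHalf
import Summits.Ventures.PercRepro2.RootLeafUMixK
import Summits.Ventures.PercRepro2.RootLeafUCoinGraph
import Summits.Ventures.PercRepro2.RootLeafUCoinShare

/-!
# (G4-u), the coin class: the `o ∈ K` half `T2oK ≥ 0` when `b` is adjacent exactly to `{a₂, u}`
(blind cell PercRepro2, p4 g15; S3 (G4-u) item (ab); no definitions, every mass written out)

Conventions of RootLeafUHalf / RootLeafUMixK (`L = C(u)`, `K = C(a₂)`, `Q = {u ↮ a₂}`, `PD`, `T`, `T′`,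
`D, t, t′`, `Z = P(Q)`, `d0 = P(c ∉ K)`, `hb = P(a₂ ↔ b)`, `P₀ = D + t′`, `P_o = P(PD,oK) + P(T′,oK)`,
`ℋ′ = t′·P(PD,oK) − D·P(T′,oK)`, `A = α + κ`, `β = S·D + d0·Z`, `X_b`).  In the class «`b` adjacent
exactly to `{a₂, u}`» (edges `f₁ = {b, a₂}` of weight `p₁`, `f₂ = {b, u}` of weight `p₂`;
`N = 1 − p₁p₂`, `ρ_K = p₁(1 − p₂)`, `ρ_L = (1 − p₁)p₂`) the shares of RootLeafUCoinShare give

* `N_Xb_eq`: `N·X_b = −ρ_K·ℋ′` — the mixed covariance of (MIX-K) collapses onto the BHK slack;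
* `NA_sub_eq`: `N·A − 2β·ρ_K = 2Λ`, `Λ = P₀·(N·hb − ρ_K) + ρ_L·(P₀ − d0·Z)`;
* `Lam_nonneg`: `0 ≤ Λ` (`hb ≥ p₁` since `f₁` is an edge `a₂b`, `hb ≤ 1`; `P₀ − d0·Z = Cov(1_{u∉K}, 1_{c∉K}) ≥ 0`
  by Harris for the two decreasing events);

hence `N·(A·ℋ′ + 2β·X_b) = 2·ℋ′·Λ ≥ 0` (`ℋ′ ≥ 0` is `MixK.HoK_nonneg`, BHK06 1.4), i.e. **(MIX-K) holds on the
class** (`mixK_coin`; at `p₁ = p₂ = 1` every `Q`-mass vanishes), and **`0 ≤ T2oK`** (`T2oK_nonneg_coin`,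
through `MixK.T2oK_nonneg_of_mixK`).  This is the exact share `ρ = ρ_K/N = P'(b ∈ K)` in the ρ-form of
(MIX-K): on this class the `b`-coins are independent of the rest of the configuration given `Q`, and the
theorem with `ρ = hb` (RootLeafUMixHb) is what the engine's 1,665 K-side bar cells miss by `hb − ρ_K/N`.
-/

namespace Summit.Ventures.PercRepro2

open UnionCluster CovForm

namespace RootLeafU

namespace Coin

variable {V : Type*} {E : Type*} [Fintype E] [DecidableEq E] [Fintype V] [DecidableEq V]
  {R : Type*} [Field R] [LinearOrder R] [IsStrictOrderedRing R]

section Stability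

variable {ends : E → Sym2 V} {b a₂ u : V} {f₁ f₂ : E}

omit [Fintype E] [Fintype V] [DecidableEq V] in
/-- `PD = {u ↮ a₂, c ∉ L ∪ K}` is `b`-stable. -/
lemma stable_PD (hf₁ : ends f₁ = s(b, a₂)) (hf₂ : ends f₂ = s(b, u))
    (hb2 : ∀ e, b ∈ ends e → e = f₁ ∨ e = f₂) (hba : b ≠ a₂) (hbu : b ≠ u) {c : V} (hbc : b ≠ c) :
    ∀ ω : Config E, ¬ (ω f₁ = true ∧ ω f₂ = true) →
      (ω ∈ PDEvent ends u a₂ c ↔ Function.update (Function.update ω f₁ false) f₂ false ∈ PDEvent ends u a₂ c) := by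
  intro ω hnb
  simp only [PDEvent, Dtilde, UnionCluster.inU, Set.mem_inter_iff, Set.mem_compl_iff, Set.mem_union,
    mem_connEvent]
  rw [conn_iff_off hf₁ hf₂ hb2 hba hbu hnb hbu.symm hba.symm, conn_iff_off hf₁ hf₂ hb2 hba hbu hnb hbc.symm hbu.symm,
    conn_iff_off hf₁ hf₂ hb2 hba hbu hnb hbc.symm hba.symm]

omit [Fintype E] [Fintype V] [DecidableEq V] in
/-- `T = {u ↮ a₂, c ∈ K}` is `b`-stable. -/
lemma stable_T (hf₁ : ends f₁ = s(b, a₂)) (hf₂ : ends f₂ = s(b, u))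
    (hb2 : ∀ e, b ∈ ends e → e = f₁ ∨ e = f₂) (hba : b ≠ a₂) (hbu : b ≠ u) {c : V} (hbc : b ≠ c) :
    ∀ ω : Config E, ¬ (ω f₁ = true ∧ ω f₂ = true) →
      (ω ∈ TEvent ends u a₂ c ↔ Function.update (Function.update ω f₁ false) f₂ false ∈ TEvent ends u a₂ c) := by
  intro ω hnb
  simp only [TEvent, Set.mem_inter_iff, Set.mem_compl_iff, mem_connEvent]
  rw [conn_iff_off hf₁ hf₂ hb2 hba hbu hnb hba.symm hbu.symm, conn_iff_off hf₁ hf₂ hb2 hba hbu hnb hba.symm hbc.symm]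

omit [Fintype E] [Fintype V] [DecidableEq V] in
/-- `T′ = {u ↮ a₂, c ∈ L}` is `b`-stable. -/
lemma stable_Tp (hf₁ : ends f₁ = s(b, a₂)) (hf₂ : ends f₂ = s(b, u))
    (hb2 : ∀ e, b ∈ ends e → e = f₁ ∨ e = f₂) (hba : b ≠ a₂) (hbu : b ≠ u) {c : V} (hbc : b ≠ c) :
    ∀ ω : Config E, ¬ (ω f₁ = true ∧ ω f₂ = true) →
      (ω ∈ TEvent ends a₂ u c ↔ Function.update (Function.update ω f₁ false) f₂ false ∈ TEvent ends a₂ u c) := by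
  intro ω hnb
  simp only [TEvent, Set.mem_inter_iff, Set.mem_compl_iff, mem_connEvent]
  rw [conn_iff_off hf₁ hf₂ hb2 hba hbu hnb hbu.symm hba.symm, conn_iff_off hf₁ hf₂ hb2 hba hbu hnb hbu.symm hbc.symm]

omit [Fintype E] [DecidableEq E] [Fintype V] [DecidableEq V] in
/-- On `PD ∩ X`, `u ↮ a₂`. -/
lemma PD_notConn {c : V} (X : Set (Config E)) : ∀ ω ∈ PDEvent ends u a₂ c ∩ X, ¬ Conn ends ω u a₂ :=
  fun _ hω => hω.1.1

omit [Fintype E] [DecidableEq E] [Fintype V] [DecidableEq V] in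
/-- On `T ∩ X`, `u ↮ a₂`. -/
lemma T_notConn {c : V} (X : Set (Config E)) : ∀ ω ∈ TEvent ends u a₂ c ∩ X, ¬ Conn ends ω u a₂ :=
  fun _ hω h => hω.1.1 (conn_symm h)

omit [Fintype E] [DecidableEq E] [Fintype V] [DecidableEq V] in
/-- On `T′ ∩ X`, `u ↮ a₂`. -/
lemma Tp_notConn {c : V} (X : Set (Config E)) : ∀ ω ∈ TEvent ends a₂ u c ∩ X, ¬ Conn ends ω u a₂ :=
  fun _ hω => hω.1.1

end Stability

section KSide

variable (p : E → R) (ends : E → Sym2 V) (o a₂ c b u : V) {f₁ f₂ : E}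

omit [Fintype V] [DecidableEq V] [LinearOrder R] [IsStrictOrderedRing R] in
/-- **The mixed term collapses**: `N·X_b = −ρ_K·ℋ′` on the coin class. -/
theorem N_Xb_eq (hf₁ : ends f₁ = s(b, a₂)) (hf₂ : ends f₂ = s(b, u))
    (hb2 : ∀ e, b ∈ ends e → e = f₁ ∨ e = f₂) (hba : b ≠ a₂) (hbu : b ≠ u) (hne : f₁ ≠ f₂)
    (hbo : b ≠ o) (hbc : b ≠ c) :
    (1 - p f₁ * p f₂) * (prob p (TEvent ends a₂ u c ∩ (connEvent ends a₂ o ∩ connEvent ends a₂ b)) * (prob p (PDEvent ends u a₂ c) + prob p (TEvent ends a₂ u c)) - prob p (TEvent ends a₂ u c ∩ connEvent ends a₂ b) * (prob p (PDEvent ends u a₂ c ∩ connEvent ends a₂ o) + prob p (TEvent ends a₂ u c ∩ connEvent ends a₂ o)) - (prob p (PDEvent ends u a₂ c ∩ (connEvent ends a₂ o ∩ connEvent ends u b)) + prob p (TEvent ends a₂ u c ∩ (connEvent ends a₂ o ∩ connEvent ends u b))) * (prob p (PDEvent ends u a₂ c) + prob p (TEvent ends a₂ u c)) + (prob p (PDEvent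 ends u a₂ c ∩ connEvent ends u b) + prob p (TEvent ends a₂ u c ∩ connEvent ends u b)) * (prob p (PDEvent ends u a₂ c ∩ connEvent ends a₂ o) + prob p (TEvent ends a₂ u c ∩ connEvent ends a₂ o))) =
      -(p f₁ * (1 - p f₂)) * (prob p (TEvent ends a₂ u c) * prob p (PDEvent ends u a₂ c ∩ connEvent ends a₂ o) - prob p (PDEvent ends u a₂ c) * prob p (TEvent ends a₂ u c ∩ connEvent ends a₂ o)) := by
  have sPD := stable_PD hf₁ hf₂ hb2 hba hbu hbc
  have sTp := stable_Tp hf₁ hf₂ hb2 hba hbu hbc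
  have soK := stable_connEvent hf₁ hf₂ hb2 hba hbu hba.symm hbo.symm (x := a₂) (y := o)
  -- the six shares
  have s1 := prob_inter_bK p hf₁ hf₂ hb2 hba hbu hne (stable_inter sTp soK) (Tp_notConn (connEvent ends a₂ o))
  have s2 := prob_inter_bK p hf₁ hf₂ hb2 hba hbu hne sTp (fun ω hω => Tp_notConn (c := c) Set.univ ω ⟨hω, trivial⟩)
  have s3 := prob_inter_bL p hf₁ hf₂ hb2 hba hbu hne (stable_inter sPD soK) (PD_notConn (connEvent ends a₂ o))
  have s4 := prob_inter_bL p hf₁ hf₂ hb2 hba hbu hne (stable_inter sTp soK) (Tp_notConn (connEvent ends a₂ o))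
  have s5 := prob_inter_bL p hf₁ hf₂ hb2 hba hbu hne sPD (fun ω hω => PD_notConn (c := c) Set.univ ω ⟨hω, trivial⟩)
  have s6 := prob_inter_bL p hf₁ hf₂ hb2 hba hbu hne sTp (fun ω hω => Tp_notConn (c := c) Set.univ ω ⟨hω, trivial⟩)
  rw [Set.inter_assoc] at s1 s3 s4
  linear_combination (prob p (PDEvent ends u a₂ c) + prob p (TEvent ends a₂ u c)) * s1 - (prob p (PDEvent ends u a₂ c ∩ connEvent ends a₂ o) + prob p (TEvent ends a₂ u c ∩ connEvent ends a₂ o)) * s2 - (prob p (PDEvent ends u a₂ c) + prob p (TEvent ends a₂ u c)) * (s3 + s4) + (prob p (PDEvent ends u a₂ c ∩ connEvent ends a₂ o) + prob p (TEvent ends a₂ u c ∩ connEvent ends a₂ o)) * (s5 + s6)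

omit [Fintype V] in
/-- **The constant collapses**: `N·A − 2β·ρ_K = 2Λ`, `Λ = P₀·(N·hb − ρ_K) + ρ_L·(P₀ − d0·Z)`. -/
theorem NA_sub_eq (hf₁ : ends f₁ = s(b, a₂)) (hf₂ : ends f₂ = s(b, u))
    (hb2 : ∀ e, b ∈ ends e → e = f₁ ∨ e = f₂) (hba : b ≠ a₂) (hbu : b ≠ u) (hne : f₁ ≠ f₂)
    (hbc : b ≠ c) :
    (1 - p f₁ * p f₂) * ((prob p (PDEvent ends u a₂ c) * prob p (connEvent ends a₂ b) + prob p (avoidAll ends a₂ {c}) * gap p ends u a₂ b) + (prob p Set.univ * EQb3 p ends u a₂ c b + prob p Set.univ * PDb p ends u a₂ c b + prob p (connEvent ends a₂ b) * EQ3 p ends u a₂ c + prob p (connEvent ends a₂ b) * prob p (avoidAll ends a₂ {u}) - (prob p Set.univ - prob p (avoidAll ends a₂ {c})) * gap p ends u a₂ b)) -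
      2 * (prob p Set.univ * prob p (PDEvent ends u a₂ c) + prob p (avoidAll ends a₂ {c}) * prob p (avoidAll ends a₂ {u})) * (p f₁ * (1 - p f₂)) =
    2 * ((prob p (PDEvent ends u a₂ c) + prob p (TEvent ends a₂ u c)) * ((1 - p f₁ * p f₂) * prob p (connEvent ends a₂ b) - p f₁ * (1 - p f₂)) + (1 - p f₁) * p f₂ * ((prob p (PDEvent ends u a₂ c) + prob p (TEvent ends a₂ u c)) - prob p (avoidAll ends a₂ {c}) * prob p (avoidAll ends a₂ {u}))) := by
  have sPD := stable_PD hf₁ hf₂ hb2 hba hbu hbc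
  have sT := stable_T hf₁ hf₂ hb2 hba hbu hbc
  have sTp := stable_Tp hf₁ hf₂ hb2 hba hbu hbc
  have hPD := fun ω hω => PD_notConn (c := c) (ends := ends) (u := u) (a₂ := a₂) Set.univ ω ⟨hω, trivial⟩
  have hT := fun ω hω => T_notConn (c := c) (ends := ends) (u := u) (a₂ := a₂) Set.univ ω ⟨hω, trivial⟩
  have hTp := fun ω hω => Tp_notConn (c := c) (ends := ends) (u := u) (a₂ := a₂) Set.univ ω ⟨hω, trivial⟩
  have s2 := prob_inter_bK p hf₁ hf₂ hb2 hba hbu hne sTp hTp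
  have s5 := prob_inter_bL p hf₁ hf₂ hb2 hba hbu hne sPD hPD
  have s6 := prob_inter_bL p hf₁ hf₂ hb2 hba hbu hne sTp hTp
  have s7 := prob_inter_bK p hf₁ hf₂ hb2 hba hbu hne sT hT
  have s8 := prob_inter_bL p hf₁ hf₂ hb2 hba hbu hne sT hT
  have s9 := prob_inter_bK p hf₁ hf₂ hb2 hba hbu hne sPD hPD
  unfold EQb3 PDb EQ3
  rw [gap_eq_Q p ends u a₂ b, Qsplit_univ p ends u a₂ c, Qsplit p ends u a₂ c (connEvent ends a₂ b),
    Qsplit p ends u a₂ c (connEvent ends u b), prob_univ]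
  linear_combination (2 - 2 * prob p (avoidAll ends a₂ {c})) * s6 + 2 * prob p (avoidAll ends a₂ {c}) * s7 - 2 * prob p (avoidAll ends a₂ {c}) * s8 + (2 * prob p (avoidAll ends a₂ {c}) - 2) * s2 + (2 - 2 * prob p (avoidAll ends a₂ {c})) * s5 + 2 * prob p (avoidAll ends a₂ {c}) * s9

omit [Fintype V] [DecidableEq V] in
/-- `hb ≥ p₁`: the edge `f₁ = {b, a₂}` alone connects `a₂` and `b`. -/
lemma edge_le_hb (hp : IsProbVec p) (hf₁ : ends f₁ = s(b, a₂)) :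
    p f₁ ≤ prob p (connEvent ends a₂ b) := by
  have h : openEdge f₁ ⊆ connEvent ends a₂ b := fun ω hω =>
    conn_of_openAdj ⟨f₁, hω, by rw [hf₁, Sym2.eq_swap]⟩
  have := prob_mono hp h
  rwa [prob_openEdge] at this

omit [Fintype V] in
/-- **`0 ≤ Λ`**: `Λ = P₀·(N·hb − ρ_K) + ρ_L·(P₀ − d0·Z)`. -/
theorem Lam_nonneg (hp : IsProbVec p) (hf₁ : ends f₁ = s(b, a₂)) :
    0 ≤ (prob p (PDEvent ends u a₂ c) + prob p (TEvent ends a₂ u c)) * ((1 - p f₁ * p f₂) * prob p (connEvent ends a₂ b) - p f₁ * (1 - p f₂)) + (1 - p f₁) * p f₂ * ((prob p (PDEvent ends u a₂ c) + prob p (TEvent ends a₂ u c)) - prob p (avoidAll ends a₂ {c}) * prob p (avoidAll ends a₂ {u})) := by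
  have h1 := hp.nonneg f₁
  have h2 := hp.nonneg f₂
  have h1' := hp.le_one f₁
  have h2' := hp.le_one f₂
  have hhb := edge_le_hb p ends a₂ b hp hf₁
  have hhb1 := prob_le_one hp (connEvent ends a₂ b)
  have hP0 : 0 ≤ prob p (PDEvent ends u a₂ c) + prob p (TEvent ends a₂ u c) :=
    add_nonneg (prob_nonneg hp _) (prob_nonneg hp _)
  -- Harris for the decreasing events `{u ∉ K}`, `{c ∉ K}`: `P₀ ≥ d0·Z`
  have hH : prob p (avoidAll ends a₂ {c}) * prob p (avoidAll ends a₂ {u}) ≤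
      prob p (PDEvent ends u a₂ c) + prob p (TEvent ends a₂ u c) := by
    rw [MixK.P0_eq, avoidAll_singleton_eq ends a₂ c, avoidAll_singleton_eq ends a₂ u, mul_comm]
    exact prob_mul_prob_le_prob_inter_of_isLowerSet hp (isUpperSet_connEvent ends a₂ u).compl
      (isUpperSet_connEvent ends a₂ c).compl
  have hA : 0 ≤ (1 - p f₁ * p f₂) * prob p (connEvent ends a₂ b) - p f₁ * (1 - p f₂) := by
    nlinarith [mul_nonneg (mul_nonneg h1 h2) (sub_nonneg.2 hhb1)]
  have hB : 0 ≤ (1 - p f₁) * p f₂ := mul_nonneg (sub_nonneg.2 h1') h2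
  nlinarith [mul_nonneg hP0 hA, mul_nonneg hB (sub_nonneg.2 hH)]

omit [Fintype V] [DecidableEq V] [LinearOrder R] [IsStrictOrderedRing R] in
/-- At `p₁ = p₂ = 1` every `PD`/`T′` mass vanishes (`Q` is null). -/
lemma P0_eq_zero_of_N (hf₁ : ends f₁ = s(b, a₂)) (hf₂ : ends f₂ = s(b, u))
    (hb2 : ∀ e, b ∈ ends e → e = f₁ ∨ e = f₂) (hba : b ≠ a₂) (hbu : b ≠ u) (hne : f₁ ≠ f₂) (hbc : b ≠ c)
    (hN : 1 - p f₁ * p f₂ = 0) :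
    prob p (PDEvent ends u a₂ c) + prob p (TEvent ends a₂ u c) = 0 := by
  have hPD := fun ω hω => PD_notConn (c := c) (ends := ends) (u := u) (a₂ := a₂) Set.univ ω ⟨hω, trivial⟩
  have hTp := fun ω hω => Tp_notConn (c := c) (ends := ends) (u := u) (a₂ := a₂) Set.univ ω ⟨hω, trivial⟩
  rw [prob_eq_off_mul p hf₁ hf₂ hne (stable_PD hf₁ hf₂ hb2 hba hbu hbc) hPD,
    prob_eq_off_mul p hf₁ hf₂ hne (stable_Tp hf₁ hf₂ hb2 hba hbu hbc) hTp, hN]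
  ring

/-- **(MIX-K) on the coin class**: `0 ≤ A·ℋ′ + 2β·X_b` — the hypothesis of `MixK.T2oK_nonneg_of_mixK`. -/
theorem mixK_coin (hp : IsProbVec p) (hf₁ : ends f₁ = s(b, a₂)) (hf₂ : ends f₂ = s(b, u))
    (hb2 : ∀ e, b ∈ ends e → e = f₁ ∨ e = f₂) (hba : b ≠ a₂) (hbu : b ≠ u) (hne : f₁ ≠ f₂)
    (hbo : b ≠ o) (hbc : b ≠ c) :
    0 ≤ ((prob p (PDEvent ends u a₂ c) * prob p (connEvent ends a₂ b) + prob p (avoidAll ends a₂ {c}) * gap p ends u a₂ b) + (prob p Set.univ * EQb3 p ends u a₂ c b + prob p Set.univ * PDb p ends u a₂ c b + prob p (connEvent ends a₂ b) * EQ3 p ends u a₂ c + prob p (connEvent ends a₂ b) * prob p (avoidAll ends a₂ {u}) - (prob p Set.univ - prob p (avoidAll ends a₂ {c})) * gap p ends u a₂ b)) * (prob p (TEvent ends a₂ u c) * prob p (PDEvent ends u a₂ c ∩ connEvent ends a₂ o) - prob p (PDEvent ends u a₂ c) * prob p (TEvent ends a₂ u c ∩ connEvent ends a₂ o)) + 2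 * (prob p Set.univ * prob p (PDEvent ends u a₂ c) + prob p (avoidAll ends a₂ {c}) * prob p (avoidAll ends a₂ {u})) * (prob p (TEvent ends a₂ u c ∩ (connEvent ends a₂ o ∩ connEvent ends a₂ b)) * (prob p (PDEvent ends u a₂ c) + prob p (TEvent ends a₂ u c)) - prob p (TEvent ends a₂ u c ∩ connEvent ends a₂ b) * (prob p (PDEvent ends u a₂ c ∩ connEvent ends a₂ o) + prob p (TEvent ends a₂ u c ∩ connEvent ends a₂ o)) - (prob p (PDEvent ends u a₂ c ∩ (connEvent ends a₂ o ∩ connEvent ends u b)) + prob p (TEvent ends a₂ u c ∩ (connEvent ends a₂ o ∩ connEvent ends u b))) * (prob p (PDEvent ends u a₂ c) + prob p (TEvent ends a₂ u c)) + (prob p (PDEvent ends u a₂ c ∩ connEvent ends u b) + prob p (TEvent ends a₂ u c ∩ connEvent ends u b)) * (prob p (PDEvent ends u a₂ c ∩ connEvent ends a₂ o) + prob p (TEvent ends a₂ u c ∩ connEvent ends a₂ o))) := by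
  have hX := N_Xb_eq p ends o a₂ c b u hf₁ hf₂ hb2 hba hbu hne hbo hbc
  have hA := NA_sub_eq p ends a₂ c b u hf₁ hf₂ hb2 hba hbu hne hbc
  have hL := Lam_nonneg p ends a₂ c b u (f₁ := f₁) (f₂ := f₂) hp hf₁
  have hH := MixK.HoK_nonneg p ends o a₂ c u hp
  have hN : 0 ≤ 1 - p f₁ * p f₂ := by
    nlinarith [hp.nonneg f₁, hp.nonneg f₂, hp.le_one f₁, hp.le_one f₂]
  rcases hN.lt_or_eq with hpos | hzero
  · -- `N > 0`: `N·(A·ℋ′ + 2β·X_b) = 2·ℋ′·Λ ≥ 0`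
    have key : (1 - p f₁ * p f₂) * (((prob p (PDEvent ends u a₂ c) * prob p (connEvent ends a₂ b) + prob p (avoidAll ends a₂ {c}) * gap p ends u a₂ b) + (prob p Set.univ * EQb3 p ends u a₂ c b + prob p Set.univ * PDb p ends u a₂ c b + prob p (connEvent ends a₂ b) * EQ3 p ends u a₂ c + prob p (connEvent ends a₂ b) * prob p (avoidAll ends a₂ {u}) - (prob p Set.univ - prob p (avoidAll ends a₂ {c})) * gap p ends u a₂ b)) * (prob p (TEvent ends a₂ u c) * prob p (PDEvent ends u a₂ c ∩ connEvent ends a₂ o) - prob p (PDEvent ends u a₂ c) * prob p (TEvent ends a₂ u c ∩ connEvent ends a₂ o)) + 2 * (prob p Set.univ * prob p (PDEvent ends u a₂ c) + prob p (avoidAll ends a₂ {c}) * prob p (avoidAll ends a₂ {u})) * (prob p (TEvent ends a₂ u c ∩ (connEvent ends a₂ o ∩ connEvent ends a₂ b)) * (prob p (PDEvent ends u a₂ c) + prob p (TEvent ends a₂ u c)) - prob p (TEvent ends a₂ u c ∩ connEvent ends a₂ b) * (prob p (PDEvent ends u a₂ c ∩ connEvent ends a₂ o) + prob p (TEvent ends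 a₂ u c ∩ connEvent ends a₂ o)) - (prob p (PDEvent ends u a₂ c ∩ (connEvent ends a₂ o ∩ connEvent ends u b)) + prob p (TEvent ends a₂ u c ∩ (connEvent ends a₂ o ∩ connEvent ends u b))) * (prob p (PDEvent ends u a₂ c) + prob p (TEvent ends a₂ u c)) + (prob p (PDEvent ends u a₂ c ∩ connEvent ends u b) + prob p (TEvent ends a₂ u c ∩ connEvent ends u b)) * (prob p (PDEvent ends u a₂ c ∩ connEvent ends a₂ o) + prob p (TEvent ends a₂ u c ∩ connEvent ends a₂ o)))) =
        2 * (prob p (TEvent ends a₂ u c) * prob p (PDEvent ends u a₂ c ∩ connEvent ends a₂ o) - prob p (PDEvent ends u a₂ c) * prob p (TEvent ends a₂ u c ∩ connEvent ends a₂ o)) * ((prob p (PDEvent ends u a₂ c) + prob p (TEvent ends a₂ u c)) * ((1 - p f₁ * p f₂) * prob p (connEvent ends a₂ b) - p f₁ * (1 - p f₂)) + (1 - p f₁) * p f₂ * ((prob p (PDEvent ends u a₂ c) + prob p (TEvent ends a₂ u c)) - prob p (avoidAll ends a₂ {c}) * prob p (avoidAll ends a₂ {u}))) := by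
      linear_combination (prob p (TEvent ends a₂ u c) * prob p (PDEvent ends u a₂ c ∩ connEvent ends a₂ o) - prob p (PDEvent ends u a₂ c) * prob p (TEvent ends a₂ u c ∩ connEvent ends a₂ o)) * hA + 2 * (prob p Set.univ * prob p (PDEvent ends u a₂ c) + prob p (avoidAll ends a₂ {c}) * prob p (avoidAll ends a₂ {u})) * hX
    have hR : 0 ≤ 2 * (prob p (TEvent ends a₂ u c) * prob p (PDEvent ends u a₂ c ∩ connEvent ends a₂ o) - prob p (PDEvent ends u a₂ c) * prob p (TEvent ends a₂ u c ∩ connEvent ends a₂ o)) * ((prob p (PDEvent ends u a₂ c) + prob p (TEvent ends a₂ u c)) * ((1 - p f₁ * p f₂) * prob p (connEvent ends a₂ b) - p f₁ * (1 - p f₂)) + (1 - p f₁) * p f₂ * ((prob p (PDEvent ends u a₂ c) + prob p (TEvent ends a₂ u c)) - prob p (avoidAll ends a₂ {c}) * prob p (avoidAll ends a₂ {u}))) :=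
      mul_nonneg (mul_nonneg zero_le_two hH) hL
    rw [← key] at hR
    exact (mul_nonneg_iff_of_pos_left hpos).1 hR
  · -- `N = 0`: every `PD`/`T′` mass vanishes
    have h0 := P0_eq_zero_of_N p ends a₂ c b u hf₁ hf₂ hb2 hba hbu hne hbc hzero.symm
    have z := MixK.prob_PD_eq_zero_of_P0 p ends a₂ c u hp h0
    have hD := (z Set.univ).1
    have hT := (z Set.univ).2
    simp only [Set.inter_univ] at hD hT
    rw [(z (connEvent ends a₂ o)).1, (z (connEvent ends a₂ o)).2,
      (z (connEvent ends a₂ o ∩ connEvent ends a₂ b)).2, (z (connEvent ends a₂ b)).2,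
      (z (connEvent ends a₂ o ∩ connEvent ends u b)).1, (z (connEvent ends a₂ o ∩ connEvent ends u b)).2,
      (z (connEvent ends u b)).1, (z (connEvent ends u b)).2, hD, hT]
    simp

/-- **`0 ≤ T2oK` on the coin class** «`b` adjacent exactly to `{a₂, u}`». -/
theorem T2oK_nonneg_coin (hp : IsProbVec p) (hf₁ : ends f₁ = s(b, a₂)) (hf₂ : ends f₂ = s(b, u))
    (hb2 : ∀ e, b ∈ ends e → e = f₁ ∨ e = f₂) (hba : b ≠ a₂) (hbu : b ≠ u) (hne : f₁ ≠ f₂)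
    (hbo : b ≠ o) (hbc : b ≠ c) : 0 ≤ T2oK p ends o a₂ c b u :=
  MixK.T2oK_nonneg_of_mixK p ends o a₂ c b u hp
    (mixK_coin p ends o a₂ c b u hp hf₁ hf₂ hb2 hba hbu hne hbo hbc)

end KSide

end Coin

end RootLeafU

end Summit.Ventures.PercRepro2
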